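import Mathlib.Analysis.SpecialFunctions.Pow.Real
import Mathlib.Analysis.SpecialFunctions.Log.Basic
import Mathlib.Analysis.Complex.ExponentialBounds
import HarnessLib

/-!
# The linear subgroup theorem on `𝔾ₐ × 𝔾ₘ^N` (Waldschmidt 1988, Thm 4.1), V-a: the parameters

Topic `Literature/NumberTheory/Transcendental`; numerical bookkeeping for the fifth file
(`LinearSubgroupGaGmConstruction.lean`) of the direct proof of [Waldschmidt1988, Thm 4.1] for
`G = 𝔾ₐ × 𝔾ₘ^N`. With `X = S^N`, `L = log₂ S + 1`, `Q = X L⁴`, the parameters are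
`D₁ = S^{N-1} L⁴` (torus degrees), `KX = X L + 1` (additive degree `+ 1`), `T₁ = C_{T1} Q`
(truncation order of the auxiliary function), `m₀ = c_m Q` (`k = 2^{m₀}` in the box principle),
`P_b + 1 = 2^{m₁}`, `m₁ = ⌊2 m₀ rows / #Λ⌋ + 1` (height of the coefficients), `R = c_R S` (radius),
`ρ = N D₁ B R`, `U = C_U Q` (the smallness exponent), `T₀ = (N+1) X L² + 1` (order of vanishing).
We prove the two inequalities the construction needs once `L` exceeds an explicit constant:

* `smallness_le_exp_neg` — the bound of part I (`LinearSubgroupGaGm.exists_smallValues`) is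
  `≤ e^{-U}`;
* `liouville_lt_one` — `e^{-U} T₀^{T₀} b^{(T₀ + KX + ℓ S'(N D₁)) d} M^{d-1} < 1`, where `M` bounds the
  conjugates of the values of the words (part III), i.e. smallness beats Liouville's inequality;

both by comparing every term with `Q = X L⁴`: the two "main" arithmetic terms `ℓ S' N D₁ log b` and
`ℓ S' N D₁ log Θ` are `c Q` with `c < C_U`, all the others are `O(Q / L)`. This is the choice
`Δ = C S^{d₁} (log S)^{b}`, `T (log S)^a = D₀ (log S)^b = D₁ S = Δ` of [Waldschmidt1988, Prop. 6.1]
(up to the normalisation of the logarithm). Everything here is PROVED; no definitions.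

## References

* [Waldschmidt1988] M. Waldschmidt, *On the transcendence methods of Gel'fond and Schneider in
  several variables*, New Advances in Transcendence Theory (A. Baker ed.), CUP 1988, 375–398, §6
  Prop. 6.1, §7 (7.3).
-/

noncomputable section

open Real Finset

namespace Literature.NumberTheory.Transcendental.LinearSubgroupGaGm

/-! ### Elementary real estimates -/

/-- `x ≤ e^B` from `log x ≤ B` (`x > 0`) (Mathlib `Real.log_le_iff_le_exp`, kept private). [folklore] -/
private theorem le_exp_of_log_le {x B : ℝ} (hx : 0 < x) (h : Real.log x ≤ B) : x ≤ Real.exp B := by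
  calc x = Real.exp (Real.log x) := (Real.exp_log hx).symm
    _ ≤ Real.exp B := Real.exp_le_exp.mpr h

/-- `log₂ S + 1 ≥ log S` (natural logarithm) for the integer logarithm. [folklore] -/
theorem log_le_natLog_two_add_one (S : ℕ) : Real.log S ≤ (Nat.log 2 S + 1 : ℕ) := by
  rcases Nat.eq_zero_or_pos S with rfl | hS
  · simp
  have h1 : (S : ℝ) < 2 ^ (Nat.log 2 S + 1) := by exact_mod_cast Nat.lt_pow_succ_log_self one_lt_two S
  have h2 : Real.log S < (Nat.log 2 S + 1 : ℕ) * Real.log 2 := by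
    rw [← Real.log_pow]
    exact Real.log_lt_log (by exact_mod_cast hS) (by exact_mod_cast h1)
  have h3 : Real.log 2 ≤ 1 := by
    have := Real.log_two_lt_d9; linarith
  have h4 : (0 : ℝ) ≤ (Nat.log 2 S + 1 : ℕ) := Nat.cast_nonneg _
  nlinarith

/-- `log₂ S + 1 → ∞`. [folklore] -/
theorem tendsto_natLog_two_add_one : Filter.Tendsto (fun S : ℕ => Nat.log 2 S + 1) Filter.atTop Filter.atTop := by
  refine Filter.tendsto_atTop_atTop.mpr fun C => ⟨2 ^ C, fun S hS => ?_⟩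
  have : C ≤ Nat.log 2 S := Nat.le_log_of_pow_le one_lt_two hS
  omega

/-- `(log₂ S + 1)^k ≤ S` eventually. [folklore] -/
theorem eventually_natLog_pow_le (k : ℕ) : ∀ᶠ S : ℕ in Filter.atTop, (Nat.log 2 S + 1) ^ k ≤ S := by
  have h1 : ∀ᶠ x : ℝ in Filter.atTop, (3 * Real.log x) ^ k ≤ x := by
    have := (Real.isLittleO_pow_log_id_atTop (n := k)).def (show (0:ℝ) < 1 / 3 ^ k by positivity)
    filter_upwards [this, Filter.eventually_ge_atTop (1:ℝ)] with x hx hx1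
    have hlog : 0 ≤ Real.log x := Real.log_nonneg hx1
    rw [Real.norm_of_nonneg (pow_nonneg hlog _), id, Real.norm_of_nonneg (by linarith)] at hx
    rw [mul_pow]
    calc (3:ℝ) ^ k * Real.log x ^ k ≤ 3 ^ k * (1 / 3 ^ k * x) := by gcongr
      _ = x := by field_simp
  have h2 : ∀ᶠ S : ℕ in Filter.atTop, ((Nat.log 2 S + 1 : ℕ) : ℝ) ≤ 3 * Real.log S := by
    filter_upwards [Filter.eventually_ge_atTop 4] with S hS
    have hpow : (2:ℝ) ^ Nat.log 2 S ≤ S := by exact_mod_cast Nat.pow_log_le_self 2 (by omega)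
    have hl : (Nat.log 2 S : ℝ) * Real.log 2 ≤ Real.log S := by
      rw [← Real.log_pow]; exact Real.log_le_log (by positivity) hpow
    have hlog2 : (1:ℝ) / 2 < Real.log 2 := by have := Real.log_two_gt_d9; linarith
    have hS' : (4:ℝ) ≤ S := by exact_mod_cast hS
    have hlogS : 1 ≤ Real.log S := by
      rw [Real.le_log_iff_exp_le (by linarith)]
      have := Real.exp_one_lt_d9; linarith
    push_cast
    nlinarith [hl, hlog2, hlogS, (Nat.cast_nonneg (Nat.log 2 S) : (0:ℝ) ≤ _)]
  have h3 := tendsto_natCast_atTop_atTop.eventually h1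
  filter_upwards [h2, h3] with S hS2 hS3
  have h4 : (0:ℝ) ≤ ((Nat.log 2 S + 1 : ℕ) : ℝ) := Nat.cast_nonneg _
  have : ((Nat.log 2 S + 1 : ℕ) : ℝ) ^ k ≤ S := (pow_le_pow_left₀ h4 hS2 k).trans hS3
  exact_mod_cast this

/-! ### The height of the coefficients: `m₁ ≤ 2 c_m (C_{T1}+2)^N X L³ + 1` -/

/-- **The ratio `rows / #Λ ≤ (C_{T1}+2)^N / L`** and the resulting bound for
`m₁ = ⌊2 m₀ rows/#Λ⌋ + 1`. [folklore] -/
theorem cast_m₁_le {n m' S Lv KX D₁ T₁ rows cardΛ m₀ m₁ CT1 cm : ℕ} (hm : m' ≤ n) (hS : 1 ≤ S)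
    (hLv : 1 ≤ Lv) (hKX : KX = S ^ (n + 1) * Lv + 1) (hD₁ : D₁ = S ^ n * Lv ^ 4)
    (hT₁ : T₁ = CT1 * (S ^ (n + 1) * Lv ^ 4)) (hrows : rows = (KX + T₁) * T₁ ^ m')
    (hcard : cardΛ = KX * D₁ ^ (n + 1)) (hm₀ : m₀ = cm * (S ^ (n + 1) * Lv ^ 4))
    (hm₁ : m₁ = 2 * m₀ * rows / cardΛ + 1) :
    (m₁ : ℝ) ≤ 2 * cm * ((CT1 : ℝ) + 2) ^ (n + 1) * ((S : ℝ) ^ (n + 1) * (Lv : ℝ) ^ 3) + 1 := by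
  have hS' : (1 : ℝ) ≤ S := by exact_mod_cast hS
  have hL' : (1 : ℝ) ≤ Lv := by exact_mod_cast hLv
  set X : ℝ := (S : ℝ) ^ (n + 1) with hX
  set Lr : ℝ := (Lv : ℝ) with hLr
  set Q : ℝ := X * Lr ^ 4 with hQ
  have hX1 : 1 ≤ X := one_le_pow₀ hS'
  have hQ1 : 1 ≤ Q := one_le_mul_of_one_le_of_one_le hX1 (one_le_pow₀ hL')
  -- `rows · L ≤ (CT1+2)^{n+1} · cardΛ`
  have hKXle : (KX : ℝ) ≤ 2 * Q := by
    rw [hKX]; push_cast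
    have : X * Lr ≤ Q := by
      rw [hQ]; exact mul_le_mul_of_nonneg_left (le_self_pow₀ hL' (by norm_num)) (by positivity)
    nlinarith
  have hKXge : X * Lr ≤ (KX : ℝ) := by rw [hKX]; push_cast; linarith
  have hrowsle : (rows : ℝ) ≤ ((CT1 : ℝ) + 2) ^ (n + 1) * Q ^ (n + 1) := by
    rw [hrows, hT₁]; push_cast
    have h1 : (KX : ℝ) + CT1 * (↑S ^ (n + 1) * ↑Lv ^ 4) ≤ (CT1 + 2) * Q := by rw [hQ, hX, hLr] at *; nlinarith
    have h2 : (CT1 : ℝ) * (↑S ^ (n + 1) * ↑Lv ^ 4) ≤ (CT1 + 2) * Q := by rw [hQ, hX, hLr] at *; nlinarith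
    have hbase : 1 ≤ ((CT1 : ℝ) + 2) * Q := by nlinarith
    calc ((KX : ℝ) + CT1 * (↑S ^ (n + 1) * ↑Lv ^ 4)) * (CT1 * (↑S ^ (n + 1) * ↑Lv ^ 4)) ^ m'
        ≤ ((CT1 + 2) * Q) * ((CT1 + 2) * Q) ^ m' := by gcongr
      _ = ((CT1 + 2) * Q) ^ (m' + 1) := by ring
      _ ≤ ((CT1 + 2) * Q) ^ (n + 1) := pow_le_pow_right₀ hbase (by omega)
      _ = ((CT1 : ℝ) + 2) ^ (n + 1) * Q ^ (n + 1) := mul_pow _ _ _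
  have hcardge : X * Lr * ((S : ℝ) ^ n * Lr ^ 4) ^ (n + 1) ≤ (cardΛ : ℝ) := by
    rw [hcard, hD₁]; push_cast
    exact mul_le_mul_of_nonneg_right hKXge (by positivity)
  have hQpow : Q ^ (n + 1) = X * ((S : ℝ) ^ n * Lr ^ 4) ^ (n + 1) := by
    rw [hQ, hX, mul_pow, mul_pow, ← pow_mul, ← pow_mul,
      show (S : ℝ) ^ ((n + 1) * (n + 1)) = (S : ℝ) ^ (n + 1) * (S : ℝ) ^ (n * (n + 1)) by
        rw [← pow_add]; congr 1; ring]
    ring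
  have hratio : (rows : ℝ) * Lr ≤ ((CT1 : ℝ) + 2) ^ (n + 1) * cardΛ := by
    calc (rows : ℝ) * Lr ≤ ((CT1 : ℝ) + 2) ^ (n + 1) * Q ^ (n + 1) * Lr :=
          mul_le_mul_of_nonneg_right hrowsle (by positivity)
      _ = ((CT1 : ℝ) + 2) ^ (n + 1) * (X * Lr * ((S : ℝ) ^ n * Lr ^ 4) ^ (n + 1)) := by
          rw [hQpow]; ring
      _ ≤ ((CT1 : ℝ) + 2) ^ (n + 1) * cardΛ := mul_le_mul_of_nonneg_left hcardge (by positivity)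
  -- the integer division
  have hcardpos : (0 : ℝ) < cardΛ := lt_of_lt_of_le (by positivity) hcardge
  have hLpos : (0 : ℝ) < Lr := by positivity
  have hdiv : ((2 * m₀ * rows / cardΛ : ℕ) : ℝ) ≤ 2 * m₀ * rows / cardΛ := by
    have := Nat.cast_div_le (m := 2 * m₀ * rows) (n := cardΛ) (α := ℝ)
    push_cast at this ⊢
    exact this
  rw [hm₁]; push_cast
  have h5 : (2 : ℝ) * m₀ * rows / cardΛ ≤ 2 * cm * ((CT1 : ℝ) + 2) ^ (n + 1) * (X * Lr ^ 3) := by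
    rw [div_le_iff₀ hcardpos, hm₀]; push_cast
    have : (2 : ℝ) * (cm * (↑S ^ (n + 1) * ↑Lv ^ 4)) * rows =
        (2 * cm * (X * Lr ^ 3)) * (rows * Lr) := by rw [hX, hLr]; ring
    rw [this]
    calc (2 * cm * (X * Lr ^ 3)) * (rows * Lr) ≤ (2 * cm * (X * Lr ^ 3)) * (((CT1 : ℝ) + 2) ^ (n + 1) * cardΛ) :=
          mul_le_mul_of_nonneg_left hratio (by positivity)
      _ = 2 * cm * ((CT1 : ℝ) + 2) ^ (n + 1) * (X * Lr ^ 3) * cardΛ := by ring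
  linarith

/-! ### The two exponential budgets (abstract form) -/

/-- `e^{-1} ≤ 1/2` (from Mathlib `Real.exp_neg_one_lt_d9`, kept private). [folklore] -/
private theorem exp_neg_one_le_half : Real.exp (-1) ≤ 1 / 2 := by
  have := Real.exp_neg_one_lt_d9; norm_num at this ⊢; linarith

/-- **Second term of the bound of part I**: if `#Λ, P_b, 2(m'+1), R^{KX} ≤ e^{Q}`,
`(m'+1)ρ ≤ C_ρ Q` and `T₁ ≥ U + (4 + C_ρ) Q + 1`, then
`#Λ P_b R^{KX} (m'+1) e^{(m'+1)ρ} 2 e^{-T₁} ≤ e^{-U}/2`. [folklore] -/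
theorem term2_le {cardΛ Pb RK mm ρ T₁ U Q Cρ : ℝ} (hcard0 : 0 ≤ cardΛ) (hPb0 : 0 ≤ Pb) (hRK0 : 0 ≤ RK)
    (hcard : cardΛ ≤ Real.exp Q) (hPb : Pb ≤ Real.exp Q) (hmm : 2 * mm ≤ Real.exp Q)
    (hRK : RK ≤ Real.exp Q) {k : ℕ} (hk : (k : ℝ) = mm) (hρ : mm * ρ ≤ Cρ * Q)
    (hT : U + (4 + Cρ) * Q + 1 ≤ T₁) :
    cardΛ * Pb * (RK * (mm * Real.exp ρ ^ k * (2 * Real.exp (-T₁)))) ≤ Real.exp (-U) / 2 := by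
  have hexpρ : Real.exp ρ ^ k = Real.exp (mm * ρ) := by rw [← Real.exp_nat_mul, hk]
  have h1 : cardΛ * Pb * (RK * (mm * Real.exp ρ ^ k * (2 * Real.exp (-T₁)))) =
      ((2 * mm) * cardΛ * Pb * (RK * Real.exp (mm * ρ))) * Real.exp (-T₁) := by rw [hexpρ]; ring
  rw [h1]
  have h2 : (2 * mm) * cardΛ * Pb * (RK * Real.exp (mm * ρ)) ≤ Real.exp (Q + Q + Q + (Q + Cρ * Q)) := by
    rw [Real.exp_add, Real.exp_add, Real.exp_add, Real.exp_add]
    exact mul_le_mul (mul_le_mul (mul_le_mul hmm hcard hcard0 (by positivity)) hPb hPb0 (by positivity))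
      (mul_le_mul hRK (Real.exp_le_exp.mpr hρ) (by positivity) (by positivity)) (by positivity) (by positivity)
  calc (2 * mm) * cardΛ * Pb * (RK * Real.exp (mm * ρ)) * Real.exp (-T₁)
      ≤ Real.exp (Q + Q + Q + (Q + Cρ * Q)) * Real.exp (-T₁) := mul_le_mul_of_nonneg_right h2 (by positivity)
    _ = Real.exp (Q + Q + Q + (Q + Cρ * Q) + -T₁) := (Real.exp_add _ _).symm
    _ ≤ Real.exp (-U - 1) := Real.exp_le_exp.mpr (by linarith)
    _ = Real.exp (-U) * Real.exp (-1) := by rw [sub_eq_add_neg, Real.exp_add]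
    _ ≤ Real.exp (-U) / 2 := by
        rw [div_eq_mul_one_div]
        exact mul_le_mul_of_nonneg_left exp_neg_one_le_half (by positivity)

/-- **First term of the bound of part I**: with `rows, #Λ, R^{KX} ≤ e^Q`, `(m'+1)ρ ≤ C_ρ Q`,
`P_b ≤ e^{c_m Q/4 + 1}`, `k = e^{m₀ log 2}`, `m₀ = c_m Q`, `U = C_U Q` and `c_m ≥ 4(C_ρ + C_U + 6)`:
`rows · 2(2 #Λ R^{KX} e^{(m'+1)ρ} P_b + 1)/k ≤ e^{-U}/2`. [folklore] -/
theorem term1_le {rows cardΛ Pb RK mm ρ U Q Cρ CU cm m₀ k₀ : ℝ} (hQ : 2 ≤ Q)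
    (hrows0 : 0 ≤ rows) (hcard1 : 1 ≤ cardΛ) (hPb1 : 1 ≤ Pb) (hRK1 : 1 ≤ RK) (hρ0 : 0 ≤ ρ)
    (hrows : rows ≤ Real.exp Q) (hcard : cardΛ ≤ Real.exp Q) (hRK : RK ≤ Real.exp Q)
    {k : ℕ} (hk : (k : ℝ) = mm) (hρ : mm * ρ ≤ Cρ * Q) (hPb : Pb ≤ Real.exp (cm * Q / 4 + 1))
    (hk₀ : k₀ = Real.exp (m₀ * Real.log 2)) (hm₀ : m₀ = cm * Q) (hU : U = CU * Q) (hCρ : 0 ≤ Cρ) (hCU : 0 ≤ CU)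
    (hcm : 4 * (Cρ + CU + 6) ≤ cm) :
    rows * (2 * ((2 * cardΛ * (RK * Real.exp ρ ^ k) * Pb + 1) / k₀)) ≤ Real.exp (-U) / 2 := by
  have hk₀pos : 0 < k₀ := by rw [hk₀]; positivity
  have hexpρ : Real.exp ρ ^ k = Real.exp (mm * ρ) := by rw [← Real.exp_nat_mul, hk]
  set Aρ : ℝ := RK * Real.exp ρ ^ k with hAρ
  have hAρ1 : 1 ≤ Aρ := one_le_mul_of_one_le_of_one_le hRK1 (one_le_pow₀ (Real.one_le_exp hρ0))
  have hAρle : Aρ ≤ Real.exp Q * Real.exp (Cρ * Q) := by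
    rw [hAρ, hexpρ]
    exact mul_le_mul hRK (Real.exp_le_exp.mpr hρ) (by positivity) (by positivity)
  have h1 : 2 * (2 * cardΛ * Aρ * Pb + 1) ≤ 6 * (cardΛ * Aρ * Pb) := by
    have : 1 ≤ cardΛ * Aρ * Pb := one_le_mul_of_one_le_of_one_le (one_le_mul_of_one_le_of_one_le hcard1 hAρ1) hPb1
    nlinarith
  have h6 : (6 : ℝ) ≤ Real.exp Q := by
    have h2 : Real.exp 2 ≤ Real.exp Q := Real.exp_le_exp.mpr hQ
    have h3 : (2.7:ℝ) < Real.exp 1 := by have := Real.exp_one_gt_d9; linarith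
    have h4 : Real.exp 2 = Real.exp 1 * Real.exp 1 := by rw [← Real.exp_add]; norm_num
    nlinarith
  have h2 : rows * (6 * (cardΛ * Aρ * Pb)) ≤
      Real.exp Q * (Real.exp Q * (Real.exp Q * (Real.exp Q * Real.exp (Cρ * Q)) * Real.exp (cm * Q / 4 + 1))) :=
    mul_le_mul hrows (mul_le_mul h6 (mul_le_mul (mul_le_mul hcard hAρle (by positivity)
      (by positivity)) hPb (by positivity) (by positivity)) (by positivity) (by positivity))
      (by positivity) (by positivity)
  have h2' : Real.exp Q * (Real.exp Q * (Real.exp Q * (Real.exp Q * Real.exp (Cρ * Q)) * Real.exp (cm * Q / 4 + 1))) =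
      Real.exp (4 * Q + Cρ * Q + (cm * Q / 4 + 1)) := by
    simp only [← Real.exp_add]; congr 1; ring
  rw [h2'] at h2
  have hlog2 : (1:ℝ) / 2 < Real.log 2 := by have := Real.log_two_gt_d9; linarith
  have h3 : 4 * Q + Cρ * Q + (cm * Q / 4 + 1) ≤ m₀ * Real.log 2 - U - 1 := by
    rw [hm₀, hU]
    have : 0 ≤ cm * Q := by nlinarith
    nlinarith
  calc rows * (2 * ((2 * cardΛ * Aρ * Pb + 1) / k₀))
      = rows * (2 * (2 * cardΛ * Aρ * Pb + 1)) / k₀ := by ring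
    _ ≤ rows * (6 * (cardΛ * Aρ * Pb)) / k₀ := by gcongr
    _ ≤ Real.exp (4 * Q + Cρ * Q + (cm * Q / 4 + 1)) / k₀ := by gcongr
    _ ≤ Real.exp (m₀ * Real.log 2 - U - 1) / k₀ := by gcongr
    _ = Real.exp (-U) * Real.exp (-1) := by
        rw [div_eq_iff hk₀pos.ne', hk₀, ← Real.exp_add, ← Real.exp_add]; congr 1; ring
    _ ≤ Real.exp (-U) / 2 := by
        rw [div_eq_mul_one_div]
        exact mul_le_mul_of_nonneg_left exp_neg_one_le_half (by positivity)

/-! ### The concrete parameters: elementary bounds -/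

section Concrete

variable {n : ℕ} {S Lv : ℕ}

/-- `log X ≤ (n+1) L` and `log L ≤ L`. [folklore] -/
theorem log_pow_le (hLv : 1 ≤ Lv) (hlogS : Real.log S ≤ Lv) :
    Real.log ((S : ℝ) ^ (n + 1)) ≤ (n + 1) * (Lv : ℝ) ∧ Real.log (Lv : ℝ) ≤ Lv := by
  refine ⟨?_, Real.log_le_self (by positivity)⟩
  rw [Real.log_pow]; push_cast
  exact mul_le_mul_of_nonneg_left hlogS (by positivity)

/-- **The radius**: `R = c_R S ≥ 1` and `KX · log R ≤ X L⁴` once `L ≥ 2(c_R + 1)`. [folklore] -/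
theorem param_radius {KX : ℕ} {R cR : ℝ} (hS : 1 ≤ S) (hLv : 1 ≤ Lv) (hlogS : Real.log S ≤ Lv)
    (hKX : KX = S ^ (n + 1) * Lv + 1) (hcR : 1 ≤ cR) (hR : R = cR * S) (hbig : 2 * (cR + 1) ≤ Lv) :
    1 ≤ R ∧ (KX : ℝ) * Real.log R ≤ (S : ℝ) ^ (n + 1) * (Lv : ℝ) ^ 4 := by
  have hS1 : (1 : ℝ) ≤ S := by exact_mod_cast hS
  have hL1 : (1 : ℝ) ≤ Lv := by exact_mod_cast hLv
  have hX0 : (0 : ℝ) ≤ (S : ℝ) ^ (n + 1) := by positivity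
  have hR1 : 1 ≤ R := by rw [hR]; nlinarith
  refine ⟨hR1, ?_⟩
  have hlogR : Real.log R ≤ cR + Lv := by
    rw [hR, Real.log_mul (by positivity) (by positivity)]
    exact add_le_add (Real.log_le_self (by positivity)) hlogS
  have hKXr : (KX : ℝ) = (S : ℝ) ^ (n + 1) * Lv + 1 := by rw [hKX]; push_cast; ring
  have hXL1 : (1 : ℝ) ≤ (S : ℝ) ^ (n + 1) * Lv := one_le_mul_of_one_le_of_one_le (one_le_pow₀ hS1) hL1
  have hKXle : (KX : ℝ) ≤ 2 * ((S : ℝ) ^ (n + 1) * Lv) := by rw [hKXr]; linarith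
  have hcR0 : 0 ≤ cR := by linarith
  set X : ℝ := (S : ℝ) ^ (n + 1)
  have hXL0 : (0:ℝ) ≤ X * Lv := by positivity
  have hLm1 : (0:ℝ) ≤ (Lv:ℝ) - 1 := by linarith
  have h0 : X * Lv ≤ X * (Lv:ℝ) ^ 2 := by nlinarith [mul_nonneg hXL0 hLm1]
  have h1 : 2 * (X * Lv) * (cR + Lv) ≤ 2 * (cR + 1) * (X * (Lv:ℝ) ^ 2) := by
    nlinarith [mul_nonneg hcR0 (sub_nonneg.mpr h0)]
  have h2 : 2 * (cR + 1) * (X * (Lv:ℝ) ^ 2) ≤ Lv * (X * (Lv:ℝ) ^ 2) := mul_le_mul_of_nonneg_right hbig (by positivity)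
  calc (KX : ℝ) * Real.log R ≤ 2 * (X * Lv) * (cR + Lv) :=
        mul_le_mul hKXle hlogR (Real.log_nonneg hR1) (by positivity)
    _ ≤ Lv * (X * (Lv:ℝ) ^ 2) := h1.trans h2
    _ = X * (Lv:ℝ) ^ 3 := by ring
    _ ≤ X * (Lv:ℝ) ^ 4 := mul_le_mul_of_nonneg_left (pow_le_pow_right₀ hL1 (by norm_num)) hX0

/-- **The exponent `ρ = N D₁ B R ≤ (C_ρ - 1) Q`**, `Q = X L⁴`. [folklore] -/
theorem param_rho {D₁ Cρn : ℕ} {R cR BΦ ρ : ℝ} (hD₁ : D₁ = S ^ n * Lv ^ 4) (hR : R = cR * S)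
    (hρ : ρ = (n + 1) * D₁ * BΦ * R) (hcR : 0 ≤ cR) (hBΦ : 0 ≤ BΦ) (hCρn : (n + 1) * BΦ * cR + 1 ≤ Cρn) :
    0 ≤ ρ ∧ ρ ≤ ((Cρn : ℝ) - 1) * ((S : ℝ) ^ (n + 1) * (Lv : ℝ) ^ 4) := by
  have hρ0 : 0 ≤ ρ := by rw [hρ, hR, hD₁]; push_cast; positivity
  refine ⟨hρ0, ?_⟩
  have hD₁S : (D₁ : ℝ) * S = (S : ℝ) ^ (n + 1) * (Lv : ℝ) ^ 4 := by rw [hD₁]; push_cast; ring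
  calc ρ = (n + 1) * BΦ * cR * ((D₁ : ℝ) * S) := by rw [hρ, hR]; ring
    _ = ((n + 1) * BΦ * cR) * ((S : ℝ) ^ (n + 1) * (Lv : ℝ) ^ 4) := by rw [hD₁S]
    _ ≤ ((Cρn : ℝ) - 1) * ((S : ℝ) ^ (n + 1) * (Lv : ℝ) ^ 4) :=
        mul_le_mul_of_nonneg_right (by linarith) (by positivity)

/-- **The number of unknowns**: `1 ≤ #Λ` and `log #Λ ≤ ((n+2)(n+1) + 4n + 6) L`. [folklore] -/
theorem param_card {KX D₁ cardΛ : ℕ} (hS : 1 ≤ S) (hLv : 1 ≤ Lv) (hlogS : Real.log S ≤ Lv)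
    (hKX : KX = S ^ (n + 1) * Lv + 1) (hD₁ : D₁ = S ^ n * Lv ^ 4) (hcard : cardΛ = KX * D₁ ^ (n + 1)) :
    1 ≤ (cardΛ : ℝ) ∧ Real.log cardΛ ≤ ((n + 2) * (n + 1) + 4 * n + 6) * (Lv : ℝ) := by
  have hS1 : (1 : ℝ) ≤ S := by exact_mod_cast hS
  have hL1 : (1 : ℝ) ≤ Lv := by exact_mod_cast hLv
  obtain ⟨hlogX, hlogL⟩ := log_pow_le (n := n) hLv hlogS
  set X : ℝ := (S : ℝ) ^ (n + 1) with hX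
  have hX1 : 1 ≤ X := one_le_pow₀ hS1
  have hKXr : (KX : ℝ) = X * Lv + 1 := by rw [hKX]; push_cast; rw [hX]
  have hKXle : (KX : ℝ) ≤ 2 * (X * Lv) := by rw [hKXr]; nlinarith
  have hD₁le : (D₁ : ℝ) ≤ X * (Lv : ℝ) ^ 4 := by
    rw [hD₁]; push_cast; rw [hX]
    exact mul_le_mul_of_nonneg_right (pow_le_pow_right₀ hS1 (Nat.le_succ n)) (by positivity)
  have hD₁1 : (1 : ℝ) ≤ D₁ := by
    rw [hD₁]; push_cast; exact one_le_mul_of_one_le_of_one_le (one_le_pow₀ hS1) (one_le_pow₀ hL1)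
  constructor
  · rw [hcard]; push_cast
    exact one_le_mul_of_one_le_of_one_le (by rw [hKXr]; nlinarith) (one_le_pow₀ hD₁1)
  have hcardle : (cardΛ : ℝ) ≤ 2 * (X * Lv) * (X * (Lv : ℝ) ^ 4) ^ (n + 1) := by
    rw [hcard]; push_cast
    exact mul_le_mul hKXle (pow_le_pow_left₀ (by positivity) hD₁le _) (by positivity) (by positivity)
  have hcpos : (0 : ℝ) < cardΛ := by rw [hcard]; push_cast; rw [hKXr]; positivity
  have h1 : Real.log cardΛ ≤ Real.log (2 * (X * Lv) * (X * (Lv : ℝ) ^ 4) ^ (n + 1)) :=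
    Real.log_le_log hcpos hcardle
  have hXpos : 0 < X := by positivity
  have hLpos : (0:ℝ) < Lv := by positivity
  have e1 : Real.log (X * (Lv : ℝ) ^ 4) = Real.log X + 4 * Real.log Lv := by
    rw [Real.log_mul hXpos.ne' (by positivity), Real.log_pow (Lv : ℝ) 4]; push_cast; ring
  have e2 : Real.log (X * Lv) = Real.log X + Real.log Lv := Real.log_mul hXpos.ne' hLpos.ne'
  have e3 : Real.log (2 * (X * Lv) * (X * (Lv : ℝ) ^ 4) ^ (n + 1)) =
      Real.log 2 + (Real.log X + Real.log Lv) + (n + 1) * (Real.log X + 4 * Real.log Lv) := by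
    rw [Real.log_mul (by positivity) (by positivity), Real.log_mul (by norm_num) (by positivity), e2,
      Real.log_pow (X * (Lv : ℝ) ^ 4) (n + 1), e1]; push_cast; ring
  have h3 : Real.log 2 ≤ Lv := by have := Real.log_two_lt_d9; linarith
  rw [e3] at h1
  have hn : (0:ℝ) ≤ n := by positivity
  have hlogL0 : 0 ≤ Real.log (Lv:ℝ) := Real.log_nonneg hL1
  have hlogX0 : 0 ≤ Real.log X := Real.log_nonneg hX1
  nlinarith [mul_le_mul_of_nonneg_left hlogX hn, mul_le_mul_of_nonneg_left hlogL hn]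

/-- **The number of linear forms** `rows = (KX + T₁) T₁^{m'}`: `1 ≤ rows ≤ (C_{T1}+2)^N Q^N` and
`log rows ≤ (n+1)(C_{T1} + n + 7) L`. [folklore] -/
theorem param_rows {m' KX T₁ CT1 : ℕ} (hm : m' ≤ n) (hS : 1 ≤ S) (hLv : 1 ≤ Lv) (hlogS : Real.log S ≤ Lv)
    (hKX : KX = S ^ (n + 1) * Lv + 1) (hT₁ : T₁ = CT1 * (S ^ (n + 1) * Lv ^ 4)) (hCT1 : 1 ≤ CT1) :
    1 ≤ ((KX + T₁ : ℕ) : ℝ) * (T₁ : ℝ) ^ m' ∧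
      ((KX + T₁ : ℕ) : ℝ) * (T₁ : ℝ) ^ m' ≤
        ((CT1 : ℝ) + 2) ^ (n + 1) * ((S : ℝ) ^ (n + 1) * (Lv : ℝ) ^ 4) ^ (n + 1) ∧
      Real.log (((KX + T₁ : ℕ) : ℝ) * (T₁ : ℝ) ^ m') ≤ (n + 1) * ((CT1 : ℝ) + n + 7) * Lv := by
  have hS1 : (1 : ℝ) ≤ S := by exact_mod_cast hS
  have hL1 : (1 : ℝ) ≤ Lv := by exact_mod_cast hLv
  have hC1 : (1 : ℝ) ≤ CT1 := by exact_mod_cast hCT1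
  obtain ⟨hlogX, hlogL⟩ := log_pow_le (n := n) hLv hlogS
  set X : ℝ := (S : ℝ) ^ (n + 1) with hX
  set Q : ℝ := X * (Lv : ℝ) ^ 4 with hQ
  have hX1 : 1 ≤ X := one_le_pow₀ hS1
  have hL4 : (Lv : ℝ) ≤ (Lv : ℝ) ^ 4 := le_self_pow₀ hL1 (by norm_num)
  have hQ1 : 1 ≤ Q := one_le_mul_of_one_le_of_one_le hX1 (one_le_pow₀ hL1)
  have hXLQ : X * Lv ≤ Q := by rw [hQ]; exact mul_le_mul_of_nonneg_left hL4 (by positivity)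
  have hKXr : (KX : ℝ) = X * Lv + 1 := by rw [hKX]; push_cast; rw [hX]
  have hT₁r : (T₁ : ℝ) = CT1 * Q := by rw [hT₁]; push_cast; rw [hQ, hX]
  have h1 : (KX : ℝ) + CT1 * Q ≤ (CT1 + 2) * Q := by rw [hKXr]; nlinarith
  have hbase : 1 ≤ ((CT1 : ℝ) + 2) * Q := by nlinarith
  refine ⟨?_, ?_, ?_⟩
  · push_cast; rw [hT₁r]
    refine one_le_mul_of_one_le_of_one_le (by rw [hKXr]; nlinarith [show (0:ℝ) ≤ CT1 * Q by positivity]) ?_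
    exact one_le_pow₀ (by nlinarith)
  · push_cast; rw [hT₁r]
    calc ((KX : ℝ) + CT1 * Q) * (CT1 * Q) ^ m' ≤ ((CT1 + 2) * Q) * ((CT1 + 2) * Q) ^ m' := by
          gcongr; nlinarith
      _ = ((CT1 + 2) * Q) ^ (m' + 1) := by ring
      _ ≤ ((CT1 + 2) * Q) ^ (n + 1) := pow_le_pow_right₀ hbase (by omega)
      _ = ((CT1 : ℝ) + 2) ^ (n + 1) * Q ^ (n + 1) := mul_pow _ _ _
  · have hle : ((KX + T₁ : ℕ) : ℝ) * (T₁ : ℝ) ^ m' ≤ ((CT1 : ℝ) + 2) ^ (n + 1) * Q ^ (n + 1) := by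
      push_cast; rw [hT₁r]
      calc ((KX : ℝ) + CT1 * Q) * (CT1 * Q) ^ m' ≤ ((CT1 + 2) * Q) * ((CT1 + 2) * Q) ^ m' := by
            gcongr; nlinarith
        _ = ((CT1 + 2) * Q) ^ (m' + 1) := by ring
        _ ≤ ((CT1 + 2) * Q) ^ (n + 1) := pow_le_pow_right₀ hbase (by omega)
        _ = ((CT1 : ℝ) + 2) ^ (n + 1) * Q ^ (n + 1) := mul_pow _ _ _
    have hpos : (0 : ℝ) < ((KX + T₁ : ℕ) : ℝ) * (T₁ : ℝ) ^ m' := by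
      push_cast; rw [hT₁r, hKXr]; positivity
    have h2 := Real.log_le_log hpos hle
    have hCpos : (0:ℝ) < (CT1 : ℝ) + 2 := by positivity
    have hQpos : 0 < Q := by positivity
    have e1 : Real.log (((CT1 : ℝ) + 2) ^ (n + 1) * Q ^ (n + 1)) =
        (n + 1) * Real.log ((CT1 : ℝ) + 2) + (n + 1) * Real.log Q := by
      rw [Real.log_mul (pow_pos hCpos _).ne' (pow_pos hQpos _).ne', Real.log_pow ((CT1 : ℝ) + 2) (n + 1),
        Real.log_pow Q (n + 1)]; push_cast; ring
    rw [e1] at h2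
    have hXpos : 0 < X := by positivity
    have hlogQ : Real.log Q ≤ (n + 5) * Lv := by
      rw [hQ, Real.log_mul hXpos.ne' (by positivity), Real.log_pow (Lv : ℝ) 4]; push_cast; nlinarith [hlogX, hlogL]
    have h3 : Real.log ((CT1 : ℝ) + 2) ≤ (CT1 : ℝ) + 2 := Real.log_le_self hCpos.le
    have h4 : ((CT1 : ℝ) + 2) ≤ ((CT1 : ℝ) + 2) * Lv := by nlinarith
    have hn : (0:ℝ) ≤ n := by positivity
    nlinarith [mul_le_mul_of_nonneg_left h3 hn, mul_le_mul_of_nonneg_left hlogQ hn,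
      mul_le_mul_of_nonneg_left h4 hn]

/-- **The height** `P_b = 2^{m₁} - 1`: `1 ≤ P_b` and `log P_b ≤ m₁`. [folklore] -/
theorem param_Pb {m₁ Pb : ℕ} (hm₁ : 1 ≤ m₁) (hPb : Pb + 1 = 2 ^ m₁) :
    1 ≤ (Pb : ℝ) ∧ Real.log Pb ≤ m₁ := by
  have hPbr : (Pb : ℝ) + 1 = 2 ^ m₁ := by exact_mod_cast hPb
  have h2 : (2:ℝ) ^ 1 ≤ 2 ^ m₁ := pow_le_pow_right₀ (by norm_num) hm₁
  have hPb1 : (1 : ℝ) ≤ Pb := by linarith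
  refine ⟨hPb1, ?_⟩
  have h1 : Real.log Pb ≤ Real.log (2 ^ m₁) := Real.log_le_log (by positivity) (by linarith)
  rw [Real.log_pow] at h1
  have h3 : Real.log 2 ≤ 1 := by have := Real.log_two_lt_d9; linarith
  have h4 : (m₁ : ℝ) * Real.log 2 ≤ m₁ := by nlinarith [show (0:ℝ) ≤ m₁ by positivity]
  linarith

end Concrete

/-! ### Smallness beats Liouville's inequality -/

/-- **The exponential form of the Liouville budget**: if
`j log T₀ + e d log b + (d-1) log Y < U` (`T₀, b, Y ≥ 1`) then `e^{-U} T₀^j (b^e)^d (max 1 Y)^{d-1} < 1`.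
[folklore] -/
theorem liouville_budget {U T₀ b Y : ℝ} {j d e : ℕ} (hT₀ : 1 ≤ T₀) (hb : 1 ≤ b) (hY : 1 ≤ Y)
    (hsum : (j : ℝ) * Real.log T₀ + ((e * d : ℕ) : ℝ) * Real.log b + ((d - 1 : ℕ) : ℝ) * Real.log Y < U) :
    Real.exp (-U) * T₀ ^ j * ((b ^ e) ^ d * (max 1 Y) ^ (d - 1)) < 1 := by
  rw [max_eq_right hY, ← pow_mul]
  have h1 : T₀ ^ j = Real.exp ((j : ℝ) * Real.log T₀) := by
    rw [← Real.exp_log (by positivity : 0 < T₀), ← Real.exp_nat_mul, Real.log_exp]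
  have h2 : b ^ (e * d) = Real.exp (((e * d : ℕ) : ℝ) * Real.log b) := by
    rw [← Real.exp_log (by positivity : 0 < b), ← Real.exp_nat_mul, Real.log_exp]
  have h3 : Y ^ (d - 1) = Real.exp (((d - 1 : ℕ) : ℝ) * Real.log Y) := by
    rw [← Real.exp_log (by positivity : 0 < Y), ← Real.exp_nat_mul, Real.log_exp]
  rw [h1, h2, h3, ← Real.exp_add, ← Real.exp_add, ← Real.exp_add, Real.exp_lt_one_iff]
  linarith

section Concrete2

variable {n : ℕ} {S Lv : ℕ}

/-- **The order of vanishing** `T₀ = (n+2) X L² + 1`: `1 ≤ T₀ ≤ (n+3) X L²`, `log T₀ ≤ (2n+6) L`.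
[folklore] -/
theorem param_T₀ {T₀ : ℕ} (hS : 1 ≤ S) (hLv : 1 ≤ Lv) (hlogS : Real.log S ≤ Lv)
    (hT₀ : T₀ = (n + 2) * (S ^ (n + 1) * Lv ^ 2) + 1) :
    (1 : ℝ) ≤ T₀ ∧ (T₀ : ℝ) ≤ (n + 3) * ((S : ℝ) ^ (n + 1) * (Lv : ℝ) ^ 2) ∧
      Real.log T₀ ≤ (2 * n + 6) * (Lv : ℝ) := by
  have hS1 : (1 : ℝ) ≤ S := by exact_mod_cast hS
  have hL1 : (1 : ℝ) ≤ Lv := by exact_mod_cast hLv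
  obtain ⟨hlogX, hlogL⟩ := log_pow_le (n := n) hLv hlogS
  have hX1 : (1 : ℝ) ≤ (S : ℝ) ^ (n + 1) := one_le_pow₀ hS1
  have hXL1 : (1 : ℝ) ≤ (S : ℝ) ^ (n + 1) * (Lv : ℝ) ^ 2 := one_le_mul_of_one_le_of_one_le hX1 (one_le_pow₀ hL1)
  have hT₀r : (T₀ : ℝ) = (n + 2) * ((S : ℝ) ^ (n + 1) * (Lv : ℝ) ^ 2) + 1 := by rw [hT₀]; push_cast; ring
  have hle : (T₀ : ℝ) ≤ (n + 3) * ((S : ℝ) ^ (n + 1) * (Lv : ℝ) ^ 2) := by rw [hT₀r]; nlinarith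
  refine ⟨by rw [hT₀r]; nlinarith, hle, ?_⟩
  have hpos : (0 : ℝ) < T₀ := by rw [hT₀r]; positivity
  have h1 := Real.log_le_log hpos hle
  have hXpos : (0:ℝ) < (S : ℝ) ^ (n + 1) := by positivity
  rw [Real.log_mul (by positivity) (by positivity), Real.log_mul hXpos.ne' (by positivity),
    Real.log_pow (Lv : ℝ) 2] at h1
  have h2 : Real.log ((n : ℝ) + 3) ≤ (n : ℝ) + 3 := Real.log_le_self (by positivity)
  have hn : (0:ℝ) ≤ n := by positivity
  push_cast at h1
  nlinarith

/-- `log ((KX + (n+1) D₁) E_K) ≤ (2n + 8 + E_K) L`. [folklore] -/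
theorem param_logKXD {KX D₁ : ℕ} {EK : ℝ} (hS : 1 ≤ S) (hLv : 1 ≤ Lv) (hlogS : Real.log S ≤ Lv)
    (hKX : KX = S ^ (n + 1) * Lv + 1) (hD₁ : D₁ = S ^ n * Lv ^ 4) (hEK : 1 ≤ EK) :
    (1 : ℝ) ≤ ((KX : ℝ) + ((n + 1) * D₁ : ℕ)) * EK ∧
      Real.log (((KX : ℝ) + ((n + 1) * D₁ : ℕ)) * EK) ≤ (2 * n + 8 + EK) * (Lv : ℝ) := by
  have hS1 : (1 : ℝ) ≤ S := by exact_mod_cast hS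
  have hL1 : (1 : ℝ) ≤ Lv := by exact_mod_cast hLv
  obtain ⟨hlogX, hlogL⟩ := log_pow_le (n := n) hLv hlogS
  set X : ℝ := (S : ℝ) ^ (n + 1) with hX
  have hX1 : 1 ≤ X := one_le_pow₀ hS1
  have hL4 : (Lv : ℝ) ≤ (Lv : ℝ) ^ 4 := le_self_pow₀ hL1 (by norm_num)
  have hKXr : (KX : ℝ) = X * Lv + 1 := by rw [hKX]; push_cast; rw [hX]
  have hD₁le : (D₁ : ℝ) ≤ X * (Lv : ℝ) ^ 4 := by
    rw [hD₁]; push_cast; rw [hX]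
    exact mul_le_mul_of_nonneg_right (pow_le_pow_right₀ hS1 (Nat.le_succ n)) (by positivity)
  have hQ1 : 1 ≤ X * (Lv : ℝ) ^ 4 := one_le_mul_of_one_le_of_one_le hX1 (one_le_pow₀ hL1)
  have hsum : (KX : ℝ) + ((n + 1) * D₁ : ℕ) ≤ (n + 3) * (X * (Lv : ℝ) ^ 4) := by
    push_cast; rw [hKXr]
    have : X * Lv ≤ X * (Lv : ℝ) ^ 4 := mul_le_mul_of_nonneg_left hL4 (by positivity)
    nlinarith
  have hge : (1 : ℝ) ≤ (KX : ℝ) + ((n + 1) * D₁ : ℕ) := by push_cast; rw [hKXr]; nlinarith [show (0:ℝ) ≤ (↑n + 1) * ↑D₁ by positivity]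
  refine ⟨one_le_mul_of_one_le_of_one_le hge hEK, ?_⟩
  have hpos : (0 : ℝ) < (KX : ℝ) + ((n + 1) * D₁ : ℕ) := by linarith
  have h1 : Real.log (((KX : ℝ) + ((n + 1) * D₁ : ℕ)) * EK) ≤ Real.log ((n + 3) * (X * (Lv : ℝ) ^ 4) * EK) :=
    Real.log_le_log (by positivity) (mul_le_mul_of_nonneg_right hsum (by linarith))
  have hXpos : 0 < X := by positivity
  have e1 : Real.log ((n + 3) * (X * (Lv : ℝ) ^ 4) * EK) =
      Real.log ((n : ℝ) + 3) + (Real.log X + 4 * Real.log Lv) + Real.log EK := by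
    rw [Real.log_mul (by positivity) (by positivity), Real.log_mul (by positivity) (by positivity),
      Real.log_mul hXpos.ne' (by positivity), Real.log_pow (Lv : ℝ) 4]; push_cast; ring
  rw [e1] at h1
  have h2 : Real.log ((n : ℝ) + 3) ≤ (n : ℝ) + 3 := Real.log_le_self (by positivity)
  have h3 : Real.log EK ≤ EK := Real.log_le_self (by positivity)
  have hn : (0:ℝ) ≤ n := by positivity
  have hE0 : 0 ≤ EK := by linarith
  push_cast at h1 ⊢
  nlinarith [mul_le_mul_of_nonneg_left hL1 hE0, mul_le_mul_of_nonneg_left hL1 hn]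

/-- `log (ℓ S' A + 1) ≤ (ℓ (n+2) A + 2) L`, `S' = (n+2) S`. [folklore] -/
theorem param_loglSA {l S' : ℕ} {A : ℝ} (hS : 1 ≤ S) (hLv : 1 ≤ Lv) (hlogS : Real.log S ≤ Lv)
    (hS' : S' = (n + 2) * S) (hA : 0 ≤ A) :
    Real.log ((l : ℝ) * S' * A + 1) ≤ ((l : ℝ) * (n + 2) * A + 2) * (Lv : ℝ) := by
  have hS1 : (1 : ℝ) ≤ S := by exact_mod_cast hS
  have hL1 : (1 : ℝ) ≤ Lv := by exact_mod_cast hLv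
  have hle : (l : ℝ) * S' * A + 1 ≤ ((l : ℝ) * (n + 2) * A + 1) * S := by
    rw [hS']; push_cast; nlinarith [show (0:ℝ) ≤ (l:ℝ) * (↑n + 2) * A by positivity]
  have h1 := Real.log_le_log (by positivity) hle
  rw [Real.log_mul (by positivity) (by positivity)] at h1
  have h2 : Real.log ((l : ℝ) * (n + 2) * A + 1) ≤ (l : ℝ) * (n + 2) * A + 1 := Real.log_le_self (by positivity)
  have h0 : (0:ℝ) ≤ (l : ℝ) * (n + 2) * A := by positivity
  nlinarith [mul_le_mul_of_nonneg_left hL1 h0]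

/-- **Smallness beats Liouville** for the parameters of the construction: for every word length
`j ≤ T₀`, `j log T₀ + (j + KX + ℓS'(N D₁)) d log b + (d-1) log Y_j < U`, once `L ≥ κ` and
`C_U ≥ c_L + 2`, `c_L = d ℓ N (N+1) (log b + log Θ)`. [cite: Waldschmidt1988, §6 (Liouville's inequality)] -/
theorem liouville_param {l d b KX D₁ T₀ S' cardΛ Pb m₁ CU CT1 cm j : ℕ} {EK A Θ U : ℝ}
    (hS : 1 ≤ S) (hLv : 1 ≤ Lv) (hlogS : Real.log S ≤ Lv)
    (hKX : KX = S ^ (n + 1) * Lv + 1) (hD₁ : D₁ = S ^ n * Lv ^ 4)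
    (hT₀ : T₀ = (n + 2) * (S ^ (n + 1) * Lv ^ 2) + 1) (hS' : S' = (n + 2) * S)
    (hcard : cardΛ = KX * D₁ ^ (n + 1)) (hm₁ : 1 ≤ m₁) (hPb : Pb + 1 = 2 ^ m₁)
    (hm₁le : (m₁ : ℝ) ≤ 2 * cm * ((CT1 : ℝ) + 2) ^ (n + 1) * ((S : ℝ) ^ (n + 1) * (Lv : ℝ) ^ 3) + 1)
    (hd : 1 ≤ d) (hb : 1 ≤ b) (hEK : 1 ≤ EK) (hA : 0 ≤ A) (hΘ : 1 ≤ Θ)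
    (hU : U = CU * ((S : ℝ) ^ (n + 1) * (Lv : ℝ) ^ 4))
    (hCU : (d : ℝ) * l * (n + 1) * (n + 2) * (Real.log b + Real.log Θ) + 2 ≤ CU)
    (hbig : (n + 3) * (2 * n + 6) + (n + 5) * (d : ℝ) * b +
      d * (((n + 2) * (n + 1) + 4 * n + 6) + (2 * cm * ((CT1 : ℝ) + 2) ^ (n + 1) + 1) + (n + 3) +
        (n + 3) * (2 * n + 8 + EK) + 2 * ((l : ℝ) * (n + 2) * A + 2)) ≤ Lv)
    (hj : j ≤ T₀) :
    (j : ℝ) * Real.log T₀ + (((j + KX + l * S' * ((n + 1) * D₁)) * d : ℕ) : ℝ) * Real.log b +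
        ((d - 1 : ℕ) : ℝ) * Real.log ((cardΛ : ℝ) * Pb * ((KX : ℝ) *
          ((((KX : ℝ) + ((n + 1) * D₁ : ℕ)) * EK) ^ j *
            (((l : ℝ) * S' * A + 1) ^ KX * Θ ^ (l * S' * ((n + 1) * D₁)))))) < U := by
  have hS1 : (1 : ℝ) ≤ S := by exact_mod_cast hS
  have hL1 : (1 : ℝ) ≤ Lv := by exact_mod_cast hLv
  have hd1 : (1 : ℝ) ≤ d := by exact_mod_cast hd
  have hb1 : (1 : ℝ) ≤ b := by exact_mod_cast hb
  obtain ⟨hlogX, hlogL⟩ := log_pow_le (n := n) hLv hlogS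
  obtain ⟨hT₀1, hT₀le, hlogT₀⟩ := param_T₀ hS hLv hlogS hT₀
  obtain ⟨hKXD1, hlogKXD⟩ := param_logKXD hS hLv hlogS hKX hD₁ hEK
  have hloglSA := param_loglSA (l := l) hS hLv hlogS hS' hA
  obtain ⟨hcard1, hlogcard⟩ := param_card hS hLv hlogS hKX hD₁ hcard
  obtain ⟨hPb1, hlogPb⟩ := param_Pb hm₁ hPb
  have hX1 : 1 ≤ ((S : ℝ) ^ (n + 1)) := one_le_pow₀ hS1
  have hX0 : 0 ≤ ((S : ℝ) ^ (n + 1)) := by linarith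
  have hL0 : (0 : ℝ) ≤ Lv := by linarith
  have hXL : 1 ≤ ((S : ℝ) ^ (n + 1)) * (Lv : ℝ) ^ 3 := one_le_mul_of_one_le_of_one_le hX1 (one_le_pow₀ hL1)
  -- useful monotonicity: `c L ≤ c ((S : ℝ) ^ (n + 1)) L³`, `c ((S : ℝ) ^ (n + 1)) L² ≤ c ((S : ℝ) ^ (n + 1)) L³`
  have hL_XL3 : (Lv : ℝ) ≤ ((S : ℝ) ^ (n + 1)) * (Lv : ℝ) ^ 3 := by
    calc (Lv : ℝ) = 1 * (Lv : ℝ) ^ 1 := by ring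
      _ ≤ ((S : ℝ) ^ (n + 1)) * (Lv : ℝ) ^ 3 := mul_le_mul hX1 (pow_le_pow_right₀ hL1 (by norm_num)) (by positivity) hX0
  have hXL2_XL3 : ((S : ℝ) ^ (n + 1)) * (Lv : ℝ) ^ 2 ≤ ((S : ℝ) ^ (n + 1)) * (Lv : ℝ) ^ 3 :=
    mul_le_mul_of_nonneg_left (pow_le_pow_right₀ hL1 (by norm_num)) hX0
  have hXL1_XL3 : ((S : ℝ) ^ (n + 1)) * Lv ≤ ((S : ℝ) ^ (n + 1)) * (Lv : ℝ) ^ 3 := by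
    calc ((S : ℝ) ^ (n + 1)) * Lv = ((S : ℝ) ^ (n + 1)) * (Lv : ℝ) ^ 1 := by ring
      _ ≤ ((S : ℝ) ^ (n + 1)) * (Lv : ℝ) ^ 3 := mul_le_mul_of_nonneg_left (pow_le_pow_right₀ hL1 (by norm_num)) hX0
  -- casts of the parameters
  have hKXr : (KX : ℝ) = ((S : ℝ) ^ (n + 1)) * Lv + 1 := by rw [hKX]; push_cast; ring
  have hKXle : (KX : ℝ) ≤ 2 * (((S : ℝ) ^ (n + 1)) * Lv) := by
    rw [hKXr]; linarith only [one_le_mul_of_one_le_of_one_le hX1 hL1]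
  have hKX1 : (1 : ℝ) ≤ KX := by rw [hKXr]; linarith only [mul_nonneg hX0 hL0]
  have hM₁r : ((l * S' * ((n + 1) * D₁) : ℕ) : ℝ) = (l : ℝ) * (n + 1) * (n + 2) * (((S : ℝ) ^ (n + 1)) * (Lv : ℝ) ^ 4) := by
    rw [hS', hD₁]; push_cast; ring
  have hjr : (j : ℝ) ≤ T₀ := by exact_mod_cast hj
  have hj0 : (0 : ℝ) ≤ j := Nat.cast_nonneg _
  -- term A: `j log T₀`
  have hA' : (j : ℝ) * Real.log T₀ ≤ (n + 3) * (2 * n + 6) * (((S : ℝ) ^ (n + 1)) * (Lv : ℝ) ^ 3) := by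
    have h1 : (j : ℝ) * Real.log T₀ ≤ ((n + 3) * (((S : ℝ) ^ (n + 1)) * (Lv : ℝ) ^ 2)) * ((2 * n + 6) * Lv) :=
      mul_le_mul (hjr.trans hT₀le) hlogT₀ (Real.log_nonneg hT₀1) (by positivity)
    calc (j : ℝ) * Real.log T₀ ≤ ((n + 3) * (((S : ℝ) ^ (n + 1)) * (Lv : ℝ) ^ 2)) * ((2 * n + 6) * Lv) := h1
      _ = (n + 3) * (2 * n + 6) * (((S : ℝ) ^ (n + 1)) * (Lv : ℝ) ^ 3) := by ring
  -- term B: `(j + KX + M₁) d log b`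
  have hlogb : Real.log b ≤ b := Real.log_le_self (by positivity)
  have hlogb0 : 0 ≤ Real.log b := Real.log_nonneg hb1
  have hB' : (((j + KX + l * S' * ((n + 1) * D₁)) * d : ℕ) : ℝ) * Real.log b ≤
      (n + 5) * d * b * (((S : ℝ) ^ (n + 1)) * (Lv : ℝ) ^ 3) + (d : ℝ) * l * (n + 1) * (n + 2) * Real.log b * (((S : ℝ) ^ (n + 1)) * (Lv : ℝ) ^ 4) := by
    have e1 : (((j + KX + l * S' * ((n + 1) * D₁)) * d : ℕ) : ℝ) * Real.log b =
        (d : ℝ) * ((j : ℝ) + KX) * Real.log b + (d : ℝ) * l * (n + 1) * (n + 2) * Real.log b * (((S : ℝ) ^ (n + 1)) * (Lv : ℝ) ^ 4) := by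
      rw [Nat.cast_mul, Nat.cast_add, Nat.cast_add, hM₁r]; ring
    rw [e1]
    have h1 : (j : ℝ) + KX ≤ (n + 5) * (((S : ℝ) ^ (n + 1)) * (Lv : ℝ) ^ 3) := by
      calc (j : ℝ) + KX ≤ (n + 3) * (((S : ℝ) ^ (n + 1)) * (Lv : ℝ) ^ 2) + 2 * (((S : ℝ) ^ (n + 1)) * Lv) := add_le_add (hjr.trans hT₀le) hKXle
        _ ≤ (n + 3) * (((S : ℝ) ^ (n + 1)) * (Lv : ℝ) ^ 3) + 2 * (((S : ℝ) ^ (n + 1)) * (Lv : ℝ) ^ 3) := by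
            gcongr
        _ = (n + 5) * (((S : ℝ) ^ (n + 1)) * (Lv : ℝ) ^ 3) := by ring
    have h2 : (d : ℝ) * ((j : ℝ) + KX) * Real.log b ≤ (d : ℝ) * ((n + 5) * (((S : ℝ) ^ (n + 1)) * (Lv : ℝ) ^ 3)) * b :=
      mul_le_mul (mul_le_mul_of_nonneg_left h1 (by positivity)) hlogb hlogb0 (by positivity)
    linarith
  -- term C: `(d - 1) log Y`
  set Y : ℝ := (cardΛ : ℝ) * Pb * ((KX : ℝ) * ((((KX : ℝ) + ((n + 1) * D₁ : ℕ)) * EK) ^ j *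
      (((l : ℝ) * S' * A + 1) ^ KX * Θ ^ (l * S' * ((n + 1) * D₁))))) with hY
  have hlSA1 : (1 : ℝ) ≤ (l : ℝ) * S' * A + 1 := by linarith only [show (0:ℝ) ≤ (l : ℝ) * S' * A by positivity]
  have hY1 : 1 ≤ Y := by
    rw [hY]
    refine one_le_mul_of_one_le_of_one_le (one_le_mul_of_one_le_of_one_le hcard1 hPb1)
      (one_le_mul_of_one_le_of_one_le hKX1 (one_le_mul_of_one_le_of_one_le (one_le_pow₀ hKXD1)
        (one_le_mul_of_one_le_of_one_le (one_le_pow₀ hlSA1) (one_le_pow₀ hΘ))))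
  have hlogY : Real.log Y = Real.log cardΛ + Real.log Pb + (Real.log KX +
      ((j : ℝ) * Real.log (((KX : ℝ) + ((n + 1) * D₁ : ℕ)) * EK) +
        ((KX : ℝ) * Real.log ((l : ℝ) * S' * A + 1) + ((l * S' * ((n + 1) * D₁) : ℕ) : ℝ) * Real.log Θ))) := by
    have hA4 : (0 : ℝ) < ((KX : ℝ) + ((n + 1) * D₁ : ℕ)) * EK := by linarith
    have hA5 : (0 : ℝ) < (l : ℝ) * S' * A + 1 := by linarith
    have hΘ0 : (0 : ℝ) < Θ := by linarith
    have e1 : Real.log (((l : ℝ) * S' * A + 1) ^ KX * Θ ^ (l * S' * ((n + 1) * D₁))) =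
        (KX : ℝ) * Real.log ((l : ℝ) * S' * A + 1) + ((l * S' * ((n + 1) * D₁) : ℕ) : ℝ) * Real.log Θ := by
      rw [Real.log_mul (pow_pos hA5 _).ne' (pow_pos hΘ0 _).ne', Real.log_pow ((l : ℝ) * S' * A + 1),
        Real.log_pow Θ]
    have e2 : Real.log ((((KX : ℝ) + ((n + 1) * D₁ : ℕ)) * EK) ^ j *
        (((l : ℝ) * S' * A + 1) ^ KX * Θ ^ (l * S' * ((n + 1) * D₁)))) =
        (j : ℝ) * Real.log (((KX : ℝ) + ((n + 1) * D₁ : ℕ)) * EK) +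
          ((KX : ℝ) * Real.log ((l : ℝ) * S' * A + 1) + ((l * S' * ((n + 1) * D₁) : ℕ) : ℝ) * Real.log Θ) := by
      rw [Real.log_mul (pow_pos hA4 _).ne' (mul_pos (pow_pos hA5 _) (pow_pos hΘ0 _)).ne',
        Real.log_pow ((((KX : ℝ) + ((n + 1) * D₁ : ℕ)) * EK)), e1]
    have hKXpos : (0 : ℝ) < KX := by linarith
    have hrest : (0 : ℝ) < (((KX : ℝ) + ((n + 1) * D₁ : ℕ)) * EK) ^ j *
        (((l : ℝ) * S' * A + 1) ^ KX * Θ ^ (l * S' * ((n + 1) * D₁))) := by positivity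
    rw [hY, Real.log_mul (mul_pos (by linarith) (by linarith)).ne' (mul_pos hKXpos hrest).ne',
      Real.log_mul (by linarith : (0:ℝ) < cardΛ).ne' (by linarith : (0:ℝ) < Pb).ne',
      Real.log_mul hKXpos.ne' hrest.ne', e2]
  have hlogKX : Real.log KX ≤ (n + 3) * (((S : ℝ) ^ (n + 1)) * (Lv : ℝ) ^ 3) := by
    have h1 := Real.log_le_log (by positivity) hKXle
    rw [Real.log_mul (by norm_num) (by positivity), Real.log_mul (by positivity) (by positivity)] at h1
    have h2 : Real.log 2 ≤ 1 := by have := Real.log_two_lt_d9; linarith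
    have h3 : Real.log KX ≤ (n + 3) * Lv := by nlinarith only [h1, h2, hlogX, hlogL, hL1]
    exact h3.trans (mul_le_mul_of_nonneg_left hL_XL3 (by positivity))
  have hC1 : Real.log cardΛ ≤ ((n + 2) * (n + 1) + 4 * n + 6) * (((S : ℝ) ^ (n + 1)) * (Lv : ℝ) ^ 3) :=
    hlogcard.trans (mul_le_mul_of_nonneg_left hL_XL3 (by positivity))
  have hC2 : Real.log Pb ≤ (2 * cm * ((CT1 : ℝ) + 2) ^ (n + 1) + 1) * (((S : ℝ) ^ (n + 1)) * (Lv : ℝ) ^ 3) := by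
    refine (hlogPb.trans hm₁le).trans ?_
    nlinarith only [hlogPb, hm₁le, hXL, show (0:ℝ) ≤ 2 * cm * ((CT1 : ℝ) + 2) ^ (n + 1) by positivity]
  have hC3 : (j : ℝ) * Real.log (((KX : ℝ) + ((n + 1) * D₁ : ℕ)) * EK) ≤
      (n + 3) * (2 * n + 8 + EK) * (((S : ℝ) ^ (n + 1)) * (Lv : ℝ) ^ 3) := by
    have hE0 : 0 ≤ 2 * n + 8 + EK := by linarith
    have h1 : (j : ℝ) * Real.log (((KX : ℝ) + ((n + 1) * D₁ : ℕ)) * EK) ≤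
        ((n + 3) * (((S : ℝ) ^ (n + 1)) * (Lv : ℝ) ^ 2)) * ((2 * n + 8 + EK) * Lv) :=
      mul_le_mul (hjr.trans hT₀le) hlogKXD (Real.log_nonneg hKXD1) (by positivity)
    calc _ ≤ ((n + 3) * (((S : ℝ) ^ (n + 1)) * (Lv : ℝ) ^ 2)) * ((2 * n + 8 + EK) * Lv) := h1
      _ = (n + 3) * (2 * n + 8 + EK) * (((S : ℝ) ^ (n + 1)) * (Lv : ℝ) ^ 3) := by ring
  have hC4 : (KX : ℝ) * Real.log ((l : ℝ) * S' * A + 1) ≤ 2 * ((l : ℝ) * (n + 2) * A + 2) * (((S : ℝ) ^ (n + 1)) * (Lv : ℝ) ^ 3) := by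
    have h0 : 0 ≤ (l : ℝ) * (n + 2) * A + 2 := by positivity
    have h1 : (KX : ℝ) * Real.log ((l : ℝ) * S' * A + 1) ≤ (2 * (((S : ℝ) ^ (n + 1)) * Lv)) * (((l : ℝ) * (n + 2) * A + 2) * Lv) :=
      mul_le_mul hKXle hloglSA (Real.log_nonneg hlSA1) (by positivity)
    calc _ ≤ (2 * (((S : ℝ) ^ (n + 1)) * Lv)) * (((l : ℝ) * (n + 2) * A + 2) * Lv) := h1
      _ = 2 * ((l : ℝ) * (n + 2) * A + 2) * (((S : ℝ) ^ (n + 1)) * (Lv : ℝ) ^ 2) := by ring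
      _ ≤ 2 * ((l : ℝ) * (n + 2) * A + 2) * (((S : ℝ) ^ (n + 1)) * (Lv : ℝ) ^ 3) := mul_le_mul_of_nonneg_left hXL2_XL3 (by positivity)
  have hC5 : ((l * S' * ((n + 1) * D₁) : ℕ) : ℝ) * Real.log Θ = (l : ℝ) * (n + 1) * (n + 2) * Real.log Θ * (((S : ℝ) ^ (n + 1)) * (Lv : ℝ) ^ 4) := by
    rw [hM₁r]; ring
  have hlogΘ0 : 0 ≤ Real.log Θ := Real.log_nonneg hΘ
  set κ₀ : ℝ := ((n + 2) * (n + 1) + 4 * n + 6) + (2 * cm * ((CT1 : ℝ) + 2) ^ (n + 1) + 1) + (n + 3) +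
    (n + 3) * (2 * n + 8 + EK) + 2 * ((l : ℝ) * (n + 2) * A + 2) with hκ₀
  have hlogYle : Real.log Y ≤ κ₀ * (((S : ℝ) ^ (n + 1)) * (Lv : ℝ) ^ 3) + (l : ℝ) * (n + 1) * (n + 2) * Real.log Θ * (((S : ℝ) ^ (n + 1)) * (Lv : ℝ) ^ 4) := by
    rw [hlogY, hC5, hκ₀]; linarith only [hC1, hC2, hlogKX, hC3, hC4]
  have hC' : ((d - 1 : ℕ) : ℝ) * Real.log Y ≤ (d : ℝ) * (κ₀ * (((S : ℝ) ^ (n + 1)) * (Lv : ℝ) ^ 3)) +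
      (d : ℝ) * l * (n + 1) * (n + 2) * Real.log Θ * (((S : ℝ) ^ (n + 1)) * (Lv : ℝ) ^ 4) := by
    have hdle : ((d - 1 : ℕ) : ℝ) ≤ d := by exact_mod_cast Nat.sub_le d 1
    have hY0 : 0 ≤ Real.log Y := Real.log_nonneg hY1
    calc ((d - 1 : ℕ) : ℝ) * Real.log Y ≤ (d : ℝ) * Real.log Y := mul_le_mul_of_nonneg_right hdle hY0
      _ ≤ (d : ℝ) * (κ₀ * (((S : ℝ) ^ (n + 1)) * (Lv : ℝ) ^ 3) + (l : ℝ) * (n + 1) * (n + 2) * Real.log Θ * (((S : ℝ) ^ (n + 1)) * (Lv : ℝ) ^ 4)) :=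
          mul_le_mul_of_nonneg_left hlogYle (by positivity)
      _ = _ := by ring
  -- the main comparison
  have hκ : (n + 3) * (2 * n + 6) + (n + 5) * (d : ℝ) * b + d * κ₀ ≤ Lv := by rw [hκ₀]; exact hbig
  have hjunk : ((n + 3) * (2 * n + 6) + (n + 5) * (d : ℝ) * b + d * κ₀) * (((S : ℝ) ^ (n + 1)) * (Lv : ℝ) ^ 3) ≤ (((S : ℝ) ^ (n + 1)) * (Lv : ℝ) ^ 4) := by
    calc _ ≤ (Lv : ℝ) * (((S : ℝ) ^ (n + 1)) * (Lv : ℝ) ^ 3) := mul_le_mul_of_nonneg_right hκ (by positivity)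
      _ = (((S : ℝ) ^ (n + 1)) * (Lv : ℝ) ^ 4) := by ring
  have hmain : (d : ℝ) * l * (n + 1) * (n + 2) * Real.log b * (((S : ℝ) ^ (n + 1)) * (Lv : ℝ) ^ 4) +
      (d : ℝ) * l * (n + 1) * (n + 2) * Real.log Θ * (((S : ℝ) ^ (n + 1)) * (Lv : ℝ) ^ 4) + 2 * (((S : ℝ) ^ (n + 1)) * (Lv : ℝ) ^ 4) ≤ U := by
    rw [hU]
    have hQ0 : 0 ≤ (((S : ℝ) ^ (n + 1)) * (Lv : ℝ) ^ 4) := by positivity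
    have := mul_le_mul_of_nonneg_right hCU hQ0
    linarith only [this]
  have hQpos : 0 < (((S : ℝ) ^ (n + 1)) * (Lv : ℝ) ^ 4) := by positivity
  linarith only [hA', hB', hC', hjunk, hmain, hQpos]

end Concrete2

/-! ### The auxiliary function is smaller than `e^{-U}` -/

set_option maxHeartbeats 1600000 in
/-- **The bound of part I is `≤ e^{-U}`** for the parameters of the construction, once
`L ≥ C_big`. [cite: Waldschmidt1988, §6 Prop. 6.1] -/
theorem smallness_le_exp_neg {n m' S Lv KX D₁ T₁ cardΛ m₀ k₀ m₁ Pb CU Cρn CT1 cm : ℕ}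
    {R ρ U cR BΦ : ℝ} (hm : m' ≤ n) (hS : 2 ≤ S) (hLv : 1 ≤ Lv) (hlogS : Real.log S ≤ Lv)
    (hKX : KX = S ^ (n + 1) * Lv + 1) (hD₁ : D₁ = S ^ n * Lv ^ 4)
    (hT₁ : T₁ = CT1 * (S ^ (n + 1) * Lv ^ 4))
    (hcard : cardΛ = KX * D₁ ^ (n + 1)) (hm₀ : m₀ = cm * (S ^ (n + 1) * Lv ^ 4)) (hk₀ : k₀ = 2 ^ m₀)
    (hm₁ : m₁ = 2 * m₀ * ((KX + T₁) * T₁ ^ m') / cardΛ + 1) (hPb : Pb + 1 = 2 ^ m₁)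
    (hcR : 1 ≤ cR) (hBΦ : 1 ≤ BΦ) (hR : R = cR * S) (hρ : ρ = (n + 1) * D₁ * BΦ * R)
    (hU : U = CU * ((S : ℝ) ^ (n + 1) * (Lv : ℝ) ^ 4))
    (hCρn : (n + 1) * BΦ * cR + 1 ≤ Cρn) (hCT1 : CU + (m' + 1) * Cρn + 5 ≤ CT1)
    (hcm : 4 * ((m' + 1) * Cρn + CU + 6) ≤ cm)
    (hbig : 2 * (cR + 1) + 8 * ((CT1 : ℝ) + 2) ^ (n + 1) * (cm + 1) + ((n + 2) * (n + 1) + 4 * n + 6)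
      + (n + 1) * ((CT1 : ℝ) + n + 7) + 10 ≤ Lv) :
    ((KX + T₁ : ℕ) : ℝ) * (T₁ : ℝ) ^ m' *
          (2 * ((2 * (cardΛ : ℝ) * (R ^ KX * Real.exp ρ ^ (m' + 1)) * Pb + 1) / k₀)) +
        (cardΛ : ℝ) * Pb * (R ^ KX * ((m' + 1 : ℕ) * Real.exp ρ ^ (m' + 1) * (2 * Real.exp (-(T₁ : ℝ))))) ≤
      Real.exp (-U) := by
  have hS1 : 1 ≤ S := by omega
  have hS1r : (1 : ℝ) ≤ S := by exact_mod_cast hS1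
  have hS2r : (2 : ℝ) ≤ S := by exact_mod_cast hS
  have hL1 : (1 : ℝ) ≤ Lv := by exact_mod_cast hLv
  have hCT1_1 : 1 ≤ CT1 := by omega
  -- thresholds
  have hpos1 : (0 : ℝ) ≤ 8 * ((CT1 : ℝ) + 2) ^ (n + 1) * (cm + 1) := by positivity
  have hpos2 : (0 : ℝ) ≤ (n + 1) * ((CT1 : ℝ) + n + 7) := by positivity
  have hpos3 : (0 : ℝ) ≤ (n + 2) * (n + 1) + 4 * n + 6 := by positivity
  have hcR0 : 0 ≤ cR := by linarith
  have hB1 : 2 * (cR + 1) ≤ Lv := by linarith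
  have hB2 : 8 * ((CT1 : ℝ) + 2) ^ (n + 1) * (cm + 1) ≤ Lv := by linarith
  have hB3 : ((n + 2) * (n + 1) + 4 * n + 6 : ℝ) ≤ Lv := by linarith
  have hB4 : (n + 1) * ((CT1 : ℝ) + n + 7) ≤ Lv := by linarith
  have hB5 : (10 : ℝ) ≤ Lv := by linarith
  -- the quantities
  set X : ℝ := (S : ℝ) ^ (n + 1) with hX
  set Q : ℝ := X * (Lv : ℝ) ^ 4 with hQ
  have hX1 : 1 ≤ X := one_le_pow₀ hS1r
  have hX2 : 2 ≤ X := hS2r.trans (le_self_pow₀ hS1r (Nat.succ_ne_zero n))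
  have hL3 : (Lv : ℝ) ≤ (Lv : ℝ) ^ 3 := le_self_pow₀ hL1 (by norm_num)
  have hL4 : (Lv : ℝ) ≤ (Lv : ℝ) ^ 4 := le_self_pow₀ hL1 (by norm_num)
  have hQ1 : 1 ≤ Q := one_le_mul_of_one_le_of_one_le hX1 (one_le_pow₀ hL1)
  have hQ2 : 2 ≤ Q := hX2.trans (le_mul_of_one_le_right (by positivity) (one_le_pow₀ hL1))
  have hLLQ : (Lv : ℝ) * Lv ≤ Q := by
    calc (Lv : ℝ) * Lv ≤ (Lv : ℝ) ^ 4 := by nlinarith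
      _ ≤ Q := le_mul_of_one_le_left (by positivity) hX1
  have hLQ : (Lv : ℝ) ≤ Q := le_trans (by nlinarith) hLLQ
  have hXL3 : X * (Lv : ℝ) ^ 3 * Lv = Q := by rw [hQ]; ring
  -- the concrete bounds
  obtain ⟨hR1, hKXlogR⟩ := param_radius hS1 hLv hlogS hKX hcR hR hB1
  obtain ⟨hρ0, hρle⟩ := param_rho hD₁ hR hρ hcR0 (by linarith) hCρn
  obtain ⟨hcard1, hlogcard⟩ := param_card hS1 hLv hlogS hKX hD₁ hcard
  obtain ⟨hrows1, hrowsle, hlogrows⟩ := param_rows hm hS1 hLv hlogS hKX hT₁ hCT1_1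
  have hm₁le : (m₁ : ℝ) ≤ 2 * cm * ((CT1 : ℝ) + 2) ^ (n + 1) * (X * (Lv : ℝ) ^ 3) + 1 :=
    cast_m₁_le hm hS1 hLv hKX hD₁ hT₁ rfl hcard hm₀ hm₁
  obtain ⟨hPb1, hlogPb⟩ := param_Pb (show 1 ≤ m₁ by rw [hm₁]; exact Nat.le_add_left 1 _) hPb
  -- `≤ Q` forms
  have hKXlogR' : (KX : ℝ) * Real.log R ≤ Q := hKXlogR
  have hlogcardQ : Real.log cardΛ ≤ Q :=
    hlogcard.trans ((mul_le_mul_of_nonneg_right hB3 (by positivity)).trans hLLQ)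
  have hlogrowsQ : Real.log (((KX + T₁ : ℕ) : ℝ) * (T₁ : ℝ) ^ m') ≤ Q :=
    hlogrows.trans ((mul_le_mul_of_nonneg_right hB4 (by positivity)).trans hLLQ)
  have hm₁Q : (m₁ : ℝ) ≤ Q := by
    have h1 : 2 * cm * ((CT1 : ℝ) + 2) ^ (n + 1) * (X * (Lv : ℝ) ^ 3) ≤ Q / 2 := by
      rw [le_div_iff₀ (by norm_num : (0:ℝ) < 2), ← hXL3]
      have : 2 * (2 * (cm : ℝ) * ((CT1 : ℝ) + 2) ^ (n + 1)) ≤ Lv := by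
        nlinarith [hB2, show (0:ℝ) ≤ ((CT1:ℝ)+2)^(n+1) by positivity]
      have h0 : (0 : ℝ) ≤ X * (Lv : ℝ) ^ 3 := by positivity
      nlinarith
    linarith
  have hm₁m₀ : (m₁ : ℝ) ≤ (cm : ℝ) * Q / 4 + 1 := by
    have h1 : 2 * cm * ((CT1 : ℝ) + 2) ^ (n + 1) * (X * (Lv : ℝ) ^ 3) ≤ (cm : ℝ) * Q / 4 := by
      rw [le_div_iff₀ (by norm_num : (0:ℝ) < 4), ← hXL3]
      have : 8 * ((CT1 : ℝ) + 2) ^ (n + 1) ≤ Lv := by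
        nlinarith [hB2, show (0:ℝ) ≤ ((CT1:ℝ)+2)^(n+1) * cm by positivity]
      have h0 : (0 : ℝ) ≤ (cm : ℝ) * (X * (Lv : ℝ) ^ 3) := by positivity
      nlinarith
    linarith
  have hρC : ((m' + 1 : ℕ) : ℝ) * ρ ≤ (((m' + 1 : ℕ) : ℝ) * Cρn) * Q := by
    calc ((m' + 1 : ℕ) : ℝ) * ρ ≤ ((m' + 1 : ℕ) : ℝ) * (((Cρn : ℝ) - 1) * Q) :=
          mul_le_mul_of_nonneg_left hρle (by positivity)
      _ ≤ (((m' + 1 : ℕ) : ℝ) * Cρn) * Q := by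
          nlinarith [show (0:ℝ) ≤ ((m' + 1 : ℕ) : ℝ) * Q by positivity]
  -- exponential forms
  have hcardexp : (cardΛ : ℝ) ≤ Real.exp Q := le_exp_of_log_le (by linarith) hlogcardQ
  have hPbexp : (Pb : ℝ) ≤ Real.exp Q := le_exp_of_log_le (by linarith) (hlogPb.trans hm₁Q)
  have hPbexp' : (Pb : ℝ) ≤ Real.exp ((cm : ℝ) * Q / 4 + 1) := le_exp_of_log_le (by linarith) (hlogPb.trans hm₁m₀)
  have hrowsexp : ((KX + T₁ : ℕ) : ℝ) * (T₁ : ℝ) ^ m' ≤ Real.exp Q := le_exp_of_log_le (by linarith) hlogrowsQ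
  have hRKexp : R ^ KX ≤ Real.exp Q := by
    calc R ^ KX = Real.exp ((KX : ℝ) * Real.log R) := by
          rw [← Real.exp_log (by positivity : 0 < R), ← Real.exp_nat_mul, Real.log_exp]
      _ ≤ Real.exp Q := Real.exp_le_exp.mpr hKXlogR'
  have hmmexp : 2 * ((m' + 1 : ℕ) : ℝ) ≤ Real.exp Q := by
    have h1 : (2 : ℝ) * ((m' + 1 : ℕ) : ℝ) ≤ Q := by
      push_cast
      have : ((m':ℝ) + 1) ≤ n + 1 := by exact_mod_cast Nat.succ_le_succ hm
      nlinarith [hB3, hLQ]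
    linarith [Real.add_one_le_exp Q]
  -- the two terms
  have hT₁r : (T₁ : ℝ) = CT1 * Q := by rw [hT₁]; push_cast; rw [hQ, hX]
  have hk₀r : (k₀ : ℝ) = Real.exp ((m₀ : ℝ) * Real.log 2) := by
    rw [hk₀, Real.exp_nat_mul, Real.exp_log (by norm_num)]; push_cast; ring
  have hm₀r : (m₀ : ℝ) = cm * Q := by rw [hm₀]; push_cast; rw [hQ, hX]
  have hCT1r : U + (4 + ((m' + 1 : ℕ) : ℝ) * Cρn) * Q + 1 ≤ (T₁ : ℝ) := by
    have hc : (CU : ℝ) + ((m' + 1 : ℕ) : ℝ) * Cρn + 5 ≤ CT1 := by exact_mod_cast hCT1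
    have hQ0 : (0 : ℝ) ≤ Q := by linarith
    calc U + (4 + ((m' + 1 : ℕ) : ℝ) * Cρn) * Q + 1
        = (CU : ℝ) * Q + 4 * Q + ((m' + 1 : ℕ) : ℝ) * Cρn * Q + 1 := by rw [hU]; ring
      _ ≤ (CU : ℝ) * Q + 4 * Q + ((m' + 1 : ℕ) : ℝ) * Cρn * Q + Q := by linarith
      _ = ((CU : ℝ) + ((m' + 1 : ℕ) : ℝ) * Cρn + 5) * Q := by ring
      _ ≤ (CT1 : ℝ) * Q := mul_le_mul_of_nonneg_right hc hQ0
      _ = (T₁ : ℝ) := hT₁r.symm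
  have hcmr : 4 * (((m' + 1 : ℕ) : ℝ) * Cρn + CU + 6) ≤ (cm : ℝ) := by exact_mod_cast hcm
  have h2 := term2_le (cardΛ := (cardΛ : ℝ)) (Pb := (Pb : ℝ)) (RK := R ^ KX) (mm := ((m' + 1 : ℕ) : ℝ))
    (ρ := ρ) (T₁ := (T₁ : ℝ)) (U := U) (Q := Q) (Cρ := ((m' + 1 : ℕ) : ℝ) * Cρn) (k := m' + 1)
    (by linarith) (by linarith) (by positivity) hcardexp hPbexp hmmexp hRKexp rfl hρC hCT1r
  have h1 := term1_le (rows := ((KX + T₁ : ℕ) : ℝ) * (T₁ : ℝ) ^ m') (cardΛ := (cardΛ : ℝ)) (Pb := (Pb : ℝ))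
    (RK := R ^ KX) (mm := ((m' + 1 : ℕ) : ℝ)) (ρ := ρ) (U := U) (Q := Q) (Cρ := ((m' + 1 : ℕ) : ℝ) * Cρn)
    (CU := (CU : ℝ)) (cm := (cm : ℝ)) (m₀ := (m₀ : ℝ)) (k₀ := (k₀ : ℝ)) (k := m' + 1)
    hQ2 (by positivity) hcard1 hPb1 (one_le_pow₀ hR1) hρ0 hrowsexp hcardexp hRKexp rfl hρC hPbexp' hk₀r hm₀r
    hU (by positivity) (by positivity) hcmr
  have hsum := add_le_add h1 h2
  rw [add_halves] at hsum
  exact hsum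

end Literature.NumberTheory.Transcendental.LinearSubgroupGaGm

end
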